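import Literature.Analysis.FluidPDE.NSSereginLimitDecay
import Literature.Analysis.FluidPDE.NSSereginDecaySliceEstimate
import Literature.Analysis.FluidPDE.NSSereginDecayGronwall
import HarnessLib

/-!
# `seregin2014_limit_decay_holds`: Seregin's Theorem 1.6 / Lemma B.6 (decay of local energy solutions)

Analysis/FluidPDE proof file (theorems only) **discharging** the named fact
`Literature.Analysis.FluidPDE.seregin2014_limit_decay` (`NSSereginMildCompactness.lean`; Seregin
2014, App. B, Thm. 1.6 (B.1.11) with Lemma B.6 (B.2.6) = Kikuchi–Seregin 2007, Lemma 2.2 =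
Kang–Miura–Tsai 2021, Lemma 3.3): for `(u, p)` satisfying the clauses of Def. B.1 with a weakly
divergence-free datum `a ∈ E₂`, `∫₀ᵀ∫_{B_R(x₀)} |u|² → 0` as `|x₀| → ∞`.

The proof follows the book (PDF pp. 153–156) through the tree's bricks:
the cut-off weight `ψ_d = χ_R² φ₀(d − ·)` (`NSSereginDecayCutoff`), the local energy inequality
from `t = 0` (`NSSereginDecayEnergyFromZero`, (B.2.7)), the term estimates (B.2.8)–(B.2.22)
(`NSSereginDecaySliceTerms`, with the Calderón–Zygmund near field `NSSereginDecayPressureNear`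
and the far field `NSSereginDecayPressureFar`), the slice estimate
(`NSSereginDecaySliceEstimate`), the multiplicative inequality (B.2.5)
(`NSSereginDecayWeightedCubic`) and the Gronwall step (B.2.23) (`NSSereginDecayGronwall`),
and finally the reduction of Thm. 1.6 to the velocity part of (B.2.6)
(`seregin2014_limit_decay_of_lemmaB6`, `NSSereginLimitDecay`). The bump is fixed as
`rIn = 9/8`, `rOut = 5/4` ("`φ = 1` in `B(1)`, `spt φ ⊂ B(3/2)`", p. 153); radii `1 < R < 4`
are covered by the trivial bound `∫_{B(x₀,1)} |u(t)|² ≤ C ≤ 4C R^{-2/3}`.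

## References

* G. Seregin, *Lecture Notes on Regularity Theory for the Navier–Stokes Equations* (2014),
  doi:10.1142/9314, App. B, Thm. 1.6 and Lemma B.6 with its proof, PDF pp. 150–156. Bib key
  `Seregin2014`.
* N. Kikuchi, G. Seregin, AMS Transl. (2) 220 (2007), Lemma 2.2. Bib key `KikuchiSeregin2007`.
* K. Kang, H. Miura, T.-P. Tsai, arXiv:1812.10509, Lemma 3.3. Bib key `KangMiuraTsai2020`.
-/

noncomputable section

open MeasureTheory TopologicalSpace Set Function Filter Metric
open _root_.Topology
open scoped ENNReal NNReal RealInnerProductSpace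

namespace Literature.Analysis.FluidPDE

/-- **Seregin 2014, Thm. 1.6 / Lemma B.6 (velocity part): the named fact
`seregin2014_limit_decay` holds.** [cite: Seregin2014, App. B, Thm. 1.6 (B.1.11) and Lemma B.6 (B.2.6), PDF pp. 150–156] -/
theorem seregin2014_limit_decay_holds : seregin2014_limit_decay := by
  refine seregin2014_limit_decay_of_lemmaB6 ?_
  intro ν T hν hT C
  -- the bump `φ₀` with `rIn = 9/8`, `rOut = 5/4`
  let φ₀ : ContDiffBump (0 : EuclideanSpace ℝ (Fin 3)) := ⟨9 / 8, 5 / 4, by norm_num, by norm_num⟩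
  have hrIn : 1 < φ₀.rIn := by show (1 : ℝ) < 9 / 8; norm_num
  have hrOut32 : φ₀.rOut < 3 / 2 := by show (5 / 4 : ℝ) < 3 / 2; norm_num
  have hrOut2 : φ₀.rOut ≤ 2 := by show (5 / 4 : ℝ) ≤ 2; norm_num
  obtain ⟨K, hK⟩ := exists_seregin_sliceEstimate ν T C hν hT φ₀ hrOut32
  obtain ⟨C', hC'⟩ := exists_alphaR_le_of_sliceEstimate ν T C K hν
  refine ⟨C' + 4 * C, ?_⟩
  intro a u p ha _hadiv hsuit hp hmeas huC huG _hwc hinit hexp R hR N hN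
  obtain ⟨G, hG, huG'⟩ := huG
  have hRpos : 0 < R := by linarith
  have hcoe : (((C' + 4 * C : ℝ≥0)) : ℝ≥0∞) = (C' : ℝ≥0∞) + 4 * C := by push_cast; ring
  rcases le_or_gt 4 R with hR4 | hR4
  · -- `R ≥ 4`: Lemma B.6
    have hstar := hK a u p G ha hsuit hp hmeas huC hG huG' hinit hexp R hR4 N hN
    have hα := hC' φ₀ hrIn hrOut2 u G hG huC huG' R hR.le N hstar
    have hRR : R⁻¹ ≤ R ^ (-(2 / 3 : ℝ)) := by
      rw [← Real.rpow_neg_one]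
      exact Real.rpow_le_rpow_of_exponent_le hR.le (by norm_num)
    filter_upwards [hα] with t ht x₀
    calc ∫⁻ x in ball x₀ 1 \ ball (0 : EuclideanSpace ℝ (Fin 3)) (2 * R), ‖u t x‖ₑ ^ 2
        = ∫⁻ x in ball x₀ 1 \ ball (0 : EuclideanSpace ℝ (Fin 3)) (2 * R), ‖(1 - cutoff R x) • u t x‖ₑ ^ 2 := by
          refine setLIntegral_congr_fun (measurableSet_ball.diff measurableSet_ball) fun x hx => ?_
          have hx2 : 2 * R ≤ ‖x‖ := by
            have := hx.2
            rw [mem_ball_zero_iff, not_lt] at this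
            exact this
          rw [cutoff_eq_zero hRpos hx2, sub_zero, one_smul]
      _ ≤ ∫⁻ x in ball x₀ 1, ‖(1 - cutoff R x) • u t x‖ₑ ^ 2 := lintegral_mono_set Set.sdiff_subset
      _ ≤ ulocEnergy (fun x => (1 - cutoff R x) • u t x) :=
          lintegral_ball_le_ulocEnergy (fun x => (1 - cutoff R x) • u t x) x₀
      _ ≤ C' * (N + ENNReal.ofReal R⁻¹) := ht
      _ ≤ ((C' + 4 * C : ℝ≥0) : ℝ≥0∞) * (N + ENNReal.ofReal (R ^ (-(2 / 3 : ℝ)))) := by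
          rw [hcoe]
          exact mul_le_mul' le_self_add (add_le_add le_rfl (ENNReal.ofReal_le_ofReal hRR))
  · -- `1 < R < 4`: the trivial bound
    have hR23 : (1 : ℝ≥0∞) ≤ 4 * ENNReal.ofReal (R ^ (-(2 / 3 : ℝ))) := by
      have h1 : (4 : ℝ) ^ (-(2 / 3 : ℝ)) ≤ R ^ (-(2 / 3 : ℝ)) :=
        Real.rpow_le_rpow_of_nonpos hRpos hR4.le (by norm_num)
      have h2 : (4 : ℝ) ^ (-(1 : ℝ)) ≤ (4 : ℝ) ^ (-(2 / 3 : ℝ)) :=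
        Real.rpow_le_rpow_of_exponent_le (by norm_num) (by norm_num)
      have h3 : (4 : ℝ) ^ (-(1 : ℝ)) = 4⁻¹ := Real.rpow_neg_one 4
      have h4 : (1 : ℝ) ≤ 4 * R ^ (-(2 / 3 : ℝ)) := by
        rw [h3] at h2
        nlinarith
      calc (1 : ℝ≥0∞) = ENNReal.ofReal 1 := ENNReal.ofReal_one.symm
        _ ≤ ENNReal.ofReal (4 * R ^ (-(2 / 3 : ℝ))) := ENNReal.ofReal_le_ofReal h4
        _ = 4 * ENNReal.ofReal (R ^ (-(2 / 3 : ℝ))) := by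
            rw [ENNReal.ofReal_mul (by norm_num), ENNReal.ofReal_ofNat]
    filter_upwards [ae_restrict_mem measurableSet_Ioo] with t htI x₀
    have htIcc : t ∈ Icc 0 T := ⟨htI.1.le, htI.2.le⟩
    calc ∫⁻ x in ball x₀ 1 \ ball (0 : EuclideanSpace ℝ (Fin 3)) (2 * R), ‖u t x‖ₑ ^ 2
        ≤ ∫⁻ x in ball x₀ 1, ‖u t x‖ₑ ^ 2 := lintegral_mono_set Set.sdiff_subset
      _ ≤ C := huC t htIcc x₀
      _ = (C : ℝ≥0∞) * 1 := (mul_one _).symm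
      _ ≤ (C : ℝ≥0∞) * (4 * ENNReal.ofReal (R ^ (-(2 / 3 : ℝ)))) := mul_le_mul' le_rfl hR23
      _ = 4 * (C : ℝ≥0∞) * ENNReal.ofReal (R ^ (-(2 / 3 : ℝ))) := by ring
      _ ≤ ((C' + 4 * C : ℝ≥0) : ℝ≥0∞) * (N + ENNReal.ofReal (R ^ (-(2 / 3 : ℝ)))) := by
          rw [hcoe]
          exact mul_le_mul' le_add_self le_add_self

end Literature.Analysis.FluidPDE

end
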